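import Mathlib
import HarnessLib
import Summits.RiemannHypothesis.RiemannHypothesis.Theses.WeilParity
import Summits.RiemannHypothesis.RiemannHypothesis.Theses.WeilGroundState
import Summits.RiemannHypothesis.RiemannHypothesis.Theorems.WeilParityEvenWinsBeyondArchStubSectorContinuity
import Summits.RiemannHypothesis.RiemannHypothesis.Theorems.WeilGroundStateArchimedeanWindowSimpleEven
import Summits.RiemannHypothesis.RiemannHypothesis.Theorems.WeilGroundStateGroundStateSimpleEvenOfOddSectorGap
import Literature.NumberTheory.LFunctions.WeilGroundEnergyParitySplit
import Literature.NumberTheory.LFunctions.WeilWindowSimpleEven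

/-!
# Route WeilParity — crux `EvenWinsBeyondArch` (stmt-RiemannHypothesis-15432): RH-free reductions and
# the SPLIT GLUE `evenWinsBeyondArch_of_subs`

Prover file of the crux lead (lines `birth` and `split` of `Cruxes/EvenWinsBeyondArch/Lines/`).  With
`ε = weilGroundEnergy`, `ε_ev = weilEvenGroundEnergy`, `ε_od = weilOddGroundEnergy` (Bombieri's `μ±(e^a)`,
Suzuki's `λ_a^±`) the crux says `ε_ev(a) ≤ ε_od(a)` for every `a > (log 2)/2`, in junk-free matching form.
Everything here is sorry-free and RH-free; the RH-strength content sits in hypotheses that are ROUTE ITEMS.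

* `weilEvenGroundEnergy_ne_weilOddGroundEnergy_of_simple` — a variationally SIMPLE bottom is never a parity tie.
* `weilEvenGroundEnergy_lt_weilOddGroundEnergy_of_weilWindowSimpleEven`, `weilWindowSimpleEven_iff_weilEvenGroundEnergy_lt`
  — the Connes–van Suijlekom clause `WeilWindowSimpleEven a` is EQUIVALENT to the strict order
  `ε_ev(a) < ε_od(a)` (`←` by the landed halving theorem of the sister line); certified at `a = (log 2)/2`.
* `weilEvenGroundEnergy_lt_weilOddGroundEnergy_of_noCrossing` / `_of_anchor` — IVT propagation across the
  parity sectors from an anchor (sector continuity is LANDED: `Theorems.stub_sectorContinuity`).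
* `evenWinsBeyondArch_of_forall_le` — `(∀ a > (log 2)/2, ε_ev(a) ≤ ε_od(a)) → EvenWinsBeyondArch`.
* `evenWinsBeyondArch_of_subs` — **THE SPLIT GLUE**: route items `OnePrimeWindowSimpleEven`
  (stmt-RiemannHypothesis-18084, RH-free, certifiable) and `NoParityCrossing` (stmt-RiemannHypothesis-18085, the
  RH-bearing residue) imply the crux BY NAME (anchor `(log 3)/2`).
* `forall_weilWindowSimpleEven_iff_subs` — CALIBRATION: the two pieces are EQUIVALENT to Connes' clause
  `WeilWindowSimpleEven a` for every `a > (log 2)/2`; given the one-prime window, `NoParityCrossing` is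
  exactly "lowest eigenvalue simple and even on `a > (log 3)/2`".
* `evenWinsBeyondArch_of_sectorContinuity_of_bottomSimple` (registered sub-goal, line `birth`) and
  `evenWinsBeyondArch_of_bottomSimpleBeyondArch` — parity-free simplicity beyond `(log 2)/2` implies the crux.
* `evenWinsBeyondArch_of_groundStateSimpleEven` — the sister crux `GroundStateSimpleEven` (route
  WeilGroundState, stmt-RiemannHypothesis-1526) implies the crux (kill criterion k4, kernel-checked).

No new definitions, no named facts; Mathlib + landed tree files only. -/

-- single-conjunct summit: the mandated namespace repeats a component (D-0017)
set_option linter.dupNamespace false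

noncomputable section

namespace Summit.RiemannHypothesis.RiemannHypothesis.Theorems.EvenWinsBeyondArch

open MeasureTheory Set Filter
open scoped Real Topology ComplexConjugate
open Literature.NumberTheory.LFunctions
open Summit.RiemannHypothesis.RiemannHypothesis.Theses.WeilParity

/-! ## Constants of the window ranges -/

/-- `0 < (log 2)/2`. [folklore] -/
theorem log_two_half_pos : 0 < Real.log 2 / 2 :=
  div_pos (Real.log_pos one_lt_two) two_pos

/-- `(log 2)/2 < (log 3)/2`. [folklore] -/
theorem log_two_half_lt_log_three_half : Real.log 2 / 2 < Real.log 3 / 2 :=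
  div_lt_div_of_pos_right (Real.log_lt_log two_pos (by norm_num)) two_pos

/-! ## A simple bottom is not a tie; the Connes–van Suijlekom clause forces the strict order -/

/-- **A simple bottom cannot be a parity tie.** If at the window `a > 0` the bottom `ε(a)` is simple in
the variational sense (some `φ`, `δ > 0` with `Re Q(g) ≥ ε(a) + δ` for every normalised window test `g`
orthogonal to `φ`), then `ε_ev(a) ≠ ε_od(a)`. Proof: if `ε_ev = ε_od` then both equal `ε = min(ε_ev, ε_od)`;
pick near-minimisers `e` (even) and `o` (odd) with `Re Q < ε + δ`; with `A = ∫ conj φ·e`, `B = ∫ conj φ·o`,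
either `A = 0` or `B = 0` (then `e` or `o` itself is an admissible `g`), or the normalised combination
`g = (B e − A o)/√(|B|² + |A|²)` is a window test orthogonal to `φ` with
`Re Q(g) = (|B|² Re Q(e) + |A|² Re Q(o))/(|B|² + |A|²) < ε + δ` by parity-block-diagonality of `Q`
(`weilQuadratic_add_of_even_odd`) and `‖B e − A o‖² = |B|² + |A|²` — contradiction. [folklore] -/
theorem weilEvenGroundEnergy_ne_weilOddGroundEnergy_of_simple {a : ℝ} (ha : 0 < a) {φ : ℝ → ℂ}
    {δ : ℝ} (hδ : 0 < δ)
    (hS : ∀ g : ℝ → ℂ, IsWeilTest g → tsupport g ⊆ Set.Icc (-a) a → ∫ t, ‖g t‖ ^ 2 = (1 : ℝ) →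
      ∫ t, starRingEnd ℂ (φ t) * g t = 0 → weilGroundEnergy a + δ ≤ (weilQuadratic g).re) :
    weilEvenGroundEnergy a ≠ weilOddGroundEnergy a := by
  intro htie
  have hmin := weilGroundEnergy_eq_min_even_odd a
  have hεev : weilGroundEnergy a = weilEvenGroundEnergy a := by rw [hmin, htie, min_self]
  have hεod : weilGroundEnergy a = weilOddGroundEnergy a := by rw [hεev, htie]
  -- near-minimisers in each sector
  obtain ⟨x, hxS, hx⟩ := exists_lt_of_csInf_lt (weilWindowSphereValues_even_nonempty ha)
    (show sInf (weilWindowSphereValues (fun g ↦ ∀ t, g (-t) = g t) a) < weilGroundEnergy a + δ by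
      rw [← weilEvenGroundEnergy_eq_sInf, ← hεev]; linarith)
  obtain ⟨e, he, hes, hev, hen, rfl⟩ := hxS
  obtain ⟨y, hyS, hy⟩ := exists_lt_of_csInf_lt (weilWindowSphereValues_odd_nonempty ha)
    (show sInf (weilWindowSphereValues (fun g ↦ ∀ t, g (-t) = -g t) a) < weilGroundEnergy a + δ by
      rw [← weilOddGroundEnergy_eq_sInf, ← hεod]; linarith)
  obtain ⟨o, ho, hos, hodd, hon, rfl⟩ := hyS
  set A : ℂ := ∫ t, starRingEnd ℂ (φ t) * e t with hA
  set B : ℂ := ∫ t, starRingEnd ℂ (φ t) * o t with hB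
  by_cases hB0 : B = 0
  · have h := hS o ho hos hon hB0
    linarith
  by_cases hA0 : A = 0
  · have h := hS e he hes hen hA0
    linarith
  -- both overlaps are nonzero, hence the integrands are integrable (no junk)
  have hIe : Integrable (fun t ↦ starRingEnd ℂ (φ t) * e t) := by
    by_contra hI
    exact hA0 (integral_undef hI)
  have hIo : Integrable (fun t ↦ starRingEnd ℂ (φ t) * o t) := by
    by_contra hI
    exact hB0 (integral_undef hI)
  have hBn : 0 < ‖B‖ := norm_pos_iff.mpr hB0
  have hAn : 0 < ‖A‖ := norm_pos_iff.mpr hA0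
  set N : ℝ := ‖B‖ ^ 2 + ‖A‖ ^ 2 with hN
  have hNpos : 0 < N := add_pos (pow_pos hBn 2) (pow_pos hAn 2)
  set c : ℝ := (Real.sqrt N)⁻¹ with hc
  have hcc : c * c = N⁻¹ := by
    rw [hc, ← mul_inv, Real.mul_self_sqrt hNpos.le]
  -- the combination h = B e − A o and its normalisation g = c h
  set h : ℝ → ℂ := fun t ↦ B * e t - A * o t with hh
  set g : ℝ → ℂ := fun t ↦ (c : ℂ) * h t with hg
  have hht : IsWeilTest h := (he.const_mul B).sub' (ho.const_mul A)
  have hgt : IsWeilTest g := hht.const_mul (c : ℂ)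
  -- support
  have hgs : tsupport g ⊆ Set.Icc (-a) a := by
    refine closure_minimal (fun t ht ↦ ?_) isClosed_Icc
    by_contra hta
    apply ht
    have he0 : e t = 0 := image_eq_zero_of_notMem_tsupport fun h' ↦ hta (hes h')
    have ho0 : o t = 0 := image_eq_zero_of_notMem_tsupport fun h' ↦ hta (hos h')
    simp [hg, hh, he0, ho0]
  -- parity parts of h
  have hE : ∀ t, (h t + h (-t)) / 2 = B * e t := fun t ↦ by
    simp only [hh, hev t, hodd t]; ring
  have hO : ∀ t, (h t - h (-t)) / 2 = -A * o t := fun t ↦ by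
    simp only [hh, hev t, hodd t]; ring
  -- norm of h
  have hnormh : ∫ t, ‖h t‖ ^ 2 = N := by
    have hsplit := integral_norm_sq_evenPart_add_oddPart hht
    simp_rw [hE, hO] at hsplit
    have h1 : ∫ t, ‖B * e t‖ ^ 2 = ‖B‖ ^ 2 := by
      simp only [norm_mul, mul_pow]
      rw [integral_const_mul, hen, mul_one]
    have h2 : ∫ t, ‖-A * o t‖ ^ 2 = ‖A‖ ^ 2 := by
      simp only [norm_mul, norm_neg, mul_pow]
      rw [integral_const_mul, hon, mul_one]
    rw [← hsplit, h1, h2]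
  -- norm of g
  have hgn : ∫ t, ‖g t‖ ^ 2 = (1 : ℝ) := by
    simp only [hg, norm_mul, mul_pow, Complex.norm_real, Real.norm_eq_abs, sq_abs]
    rw [integral_const_mul, hnormh, sq, hcc, inv_mul_cancel₀ hNpos.ne']
  -- orthogonality to φ
  have hgφ : ∫ t, starRingEnd ℂ (φ t) * g t = 0 := by
    have hpt : ∀ t, starRingEnd ℂ (φ t) * g t =
        (c : ℂ) * B * (starRingEnd ℂ (φ t) * e t) - (c : ℂ) * A * (starRingEnd ℂ (φ t) * o t) := by
      intro t
      simp only [hg, hh]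
      ring
    simp_rw [hpt]
    rw [integral_sub (hIe.const_mul _) (hIo.const_mul _), integral_const_mul, integral_const_mul,
      ← hA, ← hB]
    ring
  -- the value of Q on h and g
  have hQh : (weilQuadratic h).re = ‖B‖ ^ 2 * (weilQuadratic e).re + ‖A‖ ^ 2 * (weilQuadratic o).re := by
    have hsum : h = (fun t ↦ B * e t) + fun t ↦ -A * o t := by
      funext t
      simp only [hh, Pi.add_apply]
      ring
    rw [hsum, weilQuadratic_add_of_even_odd (he.const_mul B) (ho.const_mul (-A))
      (fun t ↦ by simp only [hev t]) (fun t ↦ by simp only [hodd t]; ring),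
      Complex.add_re, weilQuadratic_const_mul, weilQuadratic_const_mul, Complex.re_ofReal_mul,
      Complex.re_ofReal_mul, Complex.normSq_neg, Complex.normSq_eq_norm_sq, Complex.normSq_eq_norm_sq]
  have hQg : (weilQuadratic g).re = N⁻¹ * (weilQuadratic h).re := by
    rw [hg, weilQuadratic_const_mul, Complex.re_ofReal_mul, Complex.normSq_ofReal, hcc]
  have hlt : (weilQuadratic h).re < N * (weilGroundEnergy a + δ) := by
    have h1 : ‖B‖ ^ 2 * (weilQuadratic e).re < ‖B‖ ^ 2 * (weilGroundEnergy a + δ) :=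
      mul_lt_mul_of_pos_left hx (pow_pos hBn 2)
    have h2 : ‖A‖ ^ 2 * (weilQuadratic o).re ≤ ‖A‖ ^ 2 * (weilGroundEnergy a + δ) :=
      mul_le_mul_of_nonneg_left hy.le (sq_nonneg _)
    rw [hQh, hN]
    linarith
  have hQg_lt : (weilQuadratic g).re < weilGroundEnergy a + δ := by
    rw [hQg]
    have h := mul_lt_mul_of_pos_left hlt (inv_pos.mpr hNpos)
    rwa [inv_mul_cancel_left₀ hNpos.ne'] at h
  -- simplicity applied to g
  have hge := hS g hgt hgs hgn hgφ
  linarith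

/-- **`WeilWindowSimpleEven a` forces `ε_ev(a) < ε_od(a)`** (`a > 0`): odd normalised window tests are
bounded below by `ε(a) + δ`, so `ε_od(a) ≥ ε(a) + δ > ε(a) = min(ε_ev(a), ε_od(a))`. [folklore] -/
theorem weilEvenGroundEnergy_lt_weilOddGroundEnergy_of_weilWindowSimpleEven {a : ℝ} (ha : 0 < a)
    (h : WeilWindowSimpleEven a) : weilEvenGroundEnergy a < weilOddGroundEnergy a := by
  obtain ⟨φ, δ, hδ, hgap⟩ := h
  have hodd : weilGroundEnergy a + δ ≤ weilOddGroundEnergy a :=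
    le_weilOddGroundEnergy_of_forall ha fun g hg hs ho hn ↦ hgap g hg hs hn (Or.inl ho)
  have hmin := weilGroundEnergy_eq_min_even_odd a
  rcases min_cases (weilEvenGroundEnergy a) (weilOddGroundEnergy a) with ⟨h1, h2⟩ | ⟨h1, h2⟩
  · rw [hmin, h1] at hodd
    linarith
  · rw [hmin, h1] at hodd
    linarith

/-- **A strict order is an odd-sector gap** of size `ε_od(a) − ε_ev(a)` (`ε(a) = min = ε_ev(a)`). [folklore] -/
theorem oddSectorGap_of_weilEvenGroundEnergy_lt {a : ℝ}
    (h : weilEvenGroundEnergy a < weilOddGroundEnergy a) :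
    ∃ δ : ℝ, 0 < δ ∧ ∀ g : ℝ → ℂ, IsWeilTest g → tsupport g ⊆ Icc (-a) a →
      ∫ t, ‖g t‖ ^ 2 = (1 : ℝ) → (∀ t, g (-t) = -g t) →
        weilGroundEnergy a + δ ≤ (weilQuadratic g).re := by
  refine ⟨weilOddGroundEnergy a - weilEvenGroundEnergy a, sub_pos.2 h, fun g hg hs hn hodd ↦ ?_⟩
  have hε : weilGroundEnergy a = weilEvenGroundEnergy a := by
    rw [weilGroundEnergy_eq_min_even_odd, min_eq_left h.le]
  have hle : weilOddGroundEnergy a ≤ (weilQuadratic g).re := weilOddGroundEnergy_le hg hs hodd hn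
  linarith

/-- **`WeilWindowSimpleEven a ↔ ε_ev(a) < ε_od(a)`** for `a > 0`: the Connes–van Suijlekom clause at a
window is EQUIVALENT to the strict order of the two sector bottoms (`→` above; `←`: a strict order is an
odd-sector gap, and the landed halving theorem `GroundStateSimpleEven.weilWindowSimpleEven_of_oddSectorGap`
— COMPACT + PAIR of the sister line — makes the bottom simple, isolated and even). [folklore] -/
theorem weilWindowSimpleEven_iff_weilEvenGroundEnergy_lt {a : ℝ} (ha : 0 < a) :
    WeilWindowSimpleEven a ↔ weilEvenGroundEnergy a < weilOddGroundEnergy a :=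
  ⟨weilEvenGroundEnergy_lt_weilOddGroundEnergy_of_weilWindowSimpleEven ha, fun h ↦
    GroundStateSimpleEven.weilWindowSimpleEven_of_oddSectorGap ha (oddSectorGap_of_weilEvenGroundEnergy_lt h)⟩

/-- **Certified initial order at the archimedean window**: `ε_ev((log 2)/2) < ε_od((log 2)/2)`, from the
tree theorem `archimedeanWindowSimpleEven_proof` (route WeilGroundState, item `ArchimedeanWindowSimpleEven`,
a kernel-checked gap certificate; that item is `WeilWindowSimpleEven ((log 2)/2)` verbatim). [folklore] -/
theorem weilEvenGroundEnergy_lt_weilOddGroundEnergy_log_two_half :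
    weilEvenGroundEnergy (Real.log 2 / 2) < weilOddGroundEnergy (Real.log 2 / 2) :=
  weilEvenGroundEnergy_lt_weilOddGroundEnergy_of_weilWindowSimpleEven log_two_half_pos
    Summit.RiemannHypothesis.RiemannHypothesis.Theorems.WeilGroundState.archimedeanWindowSimpleEven_proof

/-! ## IVT propagation across the parity sectors -/

/-- **IVT propagation from an anchor** `a₁ > 0`: continuity of both sector bottoms on `(0, ∞)`, strict
order at `a₁` and no tie on `(a₁, ∞)` give `ε_ev(a) < ε_od(a)` for every `a > a₁` (a reversal would force a
zero of the continuous `ε_od − ε_ev` on `[a₁, a]` away from `a₁`). [folklore] -/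
theorem weilEvenGroundEnergy_lt_weilOddGroundEnergy_of_noCrossing {a₁ : ℝ} (ha₁ : 0 < a₁)
    (hcont : ContinuousOn weilEvenGroundEnergy (Set.Ioi (0 : ℝ)) ∧
      ContinuousOn weilOddGroundEnergy (Set.Ioi (0 : ℝ)))
    (hanchor : weilEvenGroundEnergy a₁ < weilOddGroundEnergy a₁)
    (hne : ∀ a : ℝ, a₁ < a → weilEvenGroundEnergy a ≠ weilOddGroundEnergy a)
    {a : ℝ} (ha : a₁ < a) :
    weilEvenGroundEnergy a < weilOddGroundEnergy a := by
  set d : ℝ → ℝ := fun x ↦ weilOddGroundEnergy x - weilEvenGroundEnergy x with hd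
  have hsub : Set.Icc a₁ a ⊆ Set.Ioi 0 := fun x hx ↦ lt_of_lt_of_le ha₁ hx.1
  have hdcont : ContinuousOn d (Set.Icc a₁ a) :=
    (hcont.2.mono hsub).sub (hcont.1.mono hsub)
  have hd₁ : 0 < d a₁ := sub_pos.mpr hanchor
  have hda : d a ≠ 0 := by
    intro h0
    apply hne a ha
    simp only [hd] at h0
    linarith
  rcases lt_or_gt_of_ne hda with hneg | hpos
  · exfalso
    obtain ⟨c, hc, hdc⟩ := intermediate_value_Icc' ha.le hdcont ⟨hneg.le, hd₁.le⟩
    have hca₁ : c ≠ a₁ := by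
      intro hEq
      rw [hEq] at hdc
      linarith
    have hc' : a₁ < c := lt_of_le_of_ne hc.1 (Ne.symm hca₁)
    apply hne c hc'
    simp only [hd] at hdc
    linarith
  · exact sub_pos.mp hpos

/-- **The landed instance**: with sector continuity PROVED (`Theorems.stub_sectorContinuity`), strict order
at an anchor `a₁ > 0` and no tie beyond it give the strict order beyond it. [folklore] -/
theorem weilEvenGroundEnergy_lt_weilOddGroundEnergy_of_anchor {a₁ : ℝ} (ha₁ : 0 < a₁)
    (hanchor : weilEvenGroundEnergy a₁ < weilOddGroundEnergy a₁)
    (hne : ∀ a : ℝ, a₁ < a → weilEvenGroundEnergy a ≠ weilOddGroundEnergy a)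
    {a : ℝ} (ha : a₁ < a) :
    weilEvenGroundEnergy a < weilOddGroundEnergy a :=
  weilEvenGroundEnergy_lt_weilOddGroundEnergy_of_noCrossing ha₁ stub_sectorContinuity hanchor hne ha

/-! ## From the order to the junk-free crux -/

/-- **From `ε_ev ≤ ε_od` to the junk-free crux** (`ε_ev(a) ≤ ε_od(a) ≤ Re Q(o)` and `ε_ev(a)` is an infimum
over a nonempty set for `a > 0`); the conclusion is `EvenWinsBeyondArch` unfolded. [folklore] -/
theorem evenWinsBeyondArch_of_forall_le
    (h : ∀ a : ℝ, Real.log 2 / 2 < a → weilEvenGroundEnergy a ≤ weilOddGroundEnergy a) :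
    ∀ a : ℝ, Real.log 2 / 2 < a → ∀ o : ℝ → ℂ, Literature.NumberTheory.LFunctions.IsWeilTest o →
      tsupport o ⊆ Set.Icc (-a) a → (∀ t, o (-t) = -o t) → ∫ t, ‖o t‖ ^ 2 = (1 : ℝ) → ∀ δ : ℝ, 0 < δ →
        ∃ e : ℝ → ℂ, Literature.NumberTheory.LFunctions.IsWeilTest e ∧ tsupport e ⊆ Set.Icc (-a) a ∧
          (∀ t, e (-t) = e t) ∧ ∫ t, ‖e t‖ ^ 2 = (1 : ℝ) ∧
          (Literature.NumberTheory.LFunctions.weilQuadratic e).re ≤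
            (Literature.NumberTheory.LFunctions.weilQuadratic o).re + δ := by
  intro a ha o ho hos hodd hon δ hδ
  have ha0 : 0 < a := lt_trans log_two_half_pos ha
  have hod : weilOddGroundEnergy a ≤ (weilQuadratic o).re := weilOddGroundEnergy_le ho hos hodd hon
  have hlt : sInf (weilWindowSphereValues (fun g ↦ ∀ t, g (-t) = g t) a) < (weilQuadratic o).re + δ := by
    rw [← weilEvenGroundEnergy_eq_sInf]
    linarith [h a ha]
  obtain ⟨x, hxS, hx⟩ := exists_lt_of_csInf_lt (weilWindowSphereValues_even_nonempty ha0) hlt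
  obtain ⟨e, he, hes, hev, hen, rfl⟩ := hxS
  exact ⟨e, he, hes, hev, hen, hx.le⟩

/-- **The crux in ground-energy language**: `EvenWinsBeyondArch ↔ ∀ a > (log 2)/2, ε_ev(a) ≤ ε_od(a)`
(`→`: the matching even tests bound `ε_ev(a)` by `Re Q(o) + δ` for every odd normalised `o` and `δ > 0`,
and `ε_od(a)` is the infimum over such `o` of a nonempty set). [folklore] -/
theorem evenWinsBeyondArch_iff_forall_le :
    EvenWinsBeyondArch ↔ ∀ a : ℝ, Real.log 2 / 2 < a → weilEvenGroundEnergy a ≤ weilOddGroundEnergy a := by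
  refine ⟨fun h a ha ↦ ?_, evenWinsBeyondArch_of_forall_le⟩
  refine le_weilOddGroundEnergy_of_forall (log_two_half_pos.trans ha) fun o ho hos hodd hon ↦ ?_
  refine le_of_forall_pos_le_add fun δ hδ ↦ ?_
  obtain ⟨e, he, hes, hev, hen, hle⟩ := h a ha o ho hos hodd hon δ hδ
  exact (weilEvenGroundEnergy_le he hes hev hen).trans hle

/-- **What the crux reduces to (RH-free): no parity tie beyond the archimedean window.** Since the order
is CERTIFIED at `(log 2)/2` and both sector bottoms are continuous (landed), `EvenWinsBeyondArch` follows from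
`ε_ev(a) ≠ ε_od(a)` for every `a > (log 2)/2` alone (IVT propagation; no one-prime certificate needed). [folklore] -/
theorem evenWinsBeyondArch_of_noCrossing_beyond_arch
    (hne : ∀ a : ℝ, Real.log 2 / 2 < a → weilEvenGroundEnergy a ≠ weilOddGroundEnergy a) :
    EvenWinsBeyondArch :=
  evenWinsBeyondArch_of_forall_le fun _ ha ↦ (weilEvenGroundEnergy_lt_weilOddGroundEnergy_of_anchor
    log_two_half_pos weilEvenGroundEnergy_lt_weilOddGroundEnergy_log_two_half hne ha).le

/-! ## The split glue: the crux from the two route-level pieces -/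

/-- **Strict order on the whole range from the two pieces**: on the one-prime window from the clause, and
beyond the anchor `(log 3)/2` by IVT propagation (`NoParityCrossing` + landed sector continuity). [folklore] -/
theorem weilEvenGroundEnergy_lt_weilOddGroundEnergy_of_subs (h₁ : OnePrimeWindowSimpleEven)
    (h₂ : NoParityCrossing) {a : ℝ} (ha : Real.log 2 / 2 < a) :
    weilEvenGroundEnergy a < weilOddGroundEnergy a := by
  rcases le_or_gt a (Real.log 3 / 2) with hle | hlt
  · exact weilEvenGroundEnergy_lt_weilOddGroundEnergy_of_weilWindowSimpleEven
      (log_two_half_pos.trans ha) (h₁ a ha hle)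
  · have h23 := log_two_half_lt_log_three_half
    have hanchor : weilEvenGroundEnergy (Real.log 3 / 2) < weilOddGroundEnergy (Real.log 3 / 2) :=
      weilEvenGroundEnergy_lt_weilOddGroundEnergy_of_weilWindowSimpleEven (log_two_half_pos.trans h23)
        (h₁ _ h23 le_rfl)
    exact weilEvenGroundEnergy_lt_weilOddGroundEnergy_of_anchor (log_two_half_pos.trans h23) hanchor h₂ hlt

/-- **THE SPLIT GLUE.** The route items `OnePrimeWindowSimpleEven` (stmt-RiemannHypothesis-18084: the
Connes–van Suijlekom clause on the one-prime window, RH-free, certifiable) and `NoParityCrossing`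
(stmt-RiemannHypothesis-18085: no tie for `a > (log 3)/2`, the RH-bearing residue) imply the crux BY NAME
(strict order beyond `(log 2)/2`, then `evenWinsBeyondArch_of_forall_le`); the glue for
`route edit --split EvenWinsBeyondArch` (line `split`). [folklore] -/
theorem evenWinsBeyondArch_of_subs (h₁ : OnePrimeWindowSimpleEven) (h₂ : NoParityCrossing) :
    EvenWinsBeyondArch :=
  evenWinsBeyondArch_of_forall_le fun _ ha ↦ (weilEvenGroundEnergy_lt_weilOddGroundEnergy_of_subs h₁ h₂ ha).le

/-- **CALIBRATION of the residue.** The two pieces together are EQUIVALENT to Connes' clause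
`WeilWindowSimpleEven a` for EVERY `a > (log 2)/2` (`←`: the strict order from the pieces is an odd-sector gap,
and the landed halving theorem gives the clause); so, given the one-prime window, `NoParityCrossing` is exactly
Connes' hypothesis on `a > (log 3)/2`. [folklore] -/
theorem forall_weilWindowSimpleEven_iff_subs :
    (∀ a : ℝ, Real.log 2 / 2 < a → WeilWindowSimpleEven a) ↔
      (OnePrimeWindowSimpleEven ∧ NoParityCrossing) := by
  constructor
  · intro h
    refine ⟨fun a ha _ ↦ h a ha, fun a ha ↦ ?_⟩
    have ha' : Real.log 2 / 2 < a := log_two_half_lt_log_three_half.trans ha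
    exact (weilEvenGroundEnergy_lt_weilOddGroundEnergy_of_weilWindowSimpleEven
      (log_two_half_pos.trans ha') (h a ha')).ne
  · rintro ⟨h₁, h₂⟩ a ha
    exact (weilWindowSimpleEven_iff_weilEvenGroundEnergy_lt (log_two_half_pos.trans ha)).2
      (weilEvenGroundEnergy_lt_weilOddGroundEnergy_of_subs h₁ h₂ ha)

/-! ## Line `birth`: the crux from parity-free simplicity beyond the archimedean window -/

/-- **Line `birth`'s composition** (registered sub-goal `evenWinsBeyondArch_of_sectorContinuity_of_bottomSimple`
of stmt-RiemannHypothesis-15432): sector continuity on `(0, ∞)` and SIMPLICITY of the bottom for every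
`a > (log 2)/2` (some `φ`, `δ > 0` with `Re Q(g) ≥ ε(a) + δ` for every normalised window test `g` orthogonal
to `φ` — the parity-free half of Connes' hypothesis) imply the crux: simplicity forbids a tie
(`weilEvenGroundEnergy_ne_weilOddGroundEnergy_of_simple`), the certified order at `(log 2)/2` propagates
(`weilEvenGroundEnergy_lt_weilOddGroundEnergy_of_noCrossing`), `evenWinsBeyondArch_of_forall_le` converts.
[folklore] -/
theorem evenWinsBeyondArch_of_sectorContinuity_of_bottomSimple :
    (ContinuousOn weilEvenGroundEnergy (Set.Ioi (0 : ℝ)) ∧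
      ContinuousOn weilOddGroundEnergy (Set.Ioi (0 : ℝ))) →
    (∀ a : ℝ, Real.log 2 / 2 < a → ∃ φ : ℝ → ℂ, ∃ δ : ℝ, 0 < δ ∧ ∀ g : ℝ → ℂ, IsWeilTest g →
      tsupport g ⊆ Set.Icc (-a) a → ∫ t, ‖g t‖ ^ 2 = (1 : ℝ) →
        ∫ t, starRingEnd ℂ (φ t) * g t = 0 → weilGroundEnergy a + δ ≤ (weilQuadratic g).re) →
    Summit.RiemannHypothesis.RiemannHypothesis.Theses.WeilParity.EvenWinsBeyondArch := by
  intro h₁ h₂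
  have hne : ∀ a : ℝ, Real.log 2 / 2 < a → weilEvenGroundEnergy a ≠ weilOddGroundEnergy a := by
    intro a ha
    obtain ⟨φ, δ, hδ, hS⟩ := h₂ a ha
    exact weilEvenGroundEnergy_ne_weilOddGroundEnergy_of_simple (log_two_half_pos.trans ha) hδ hS
  exact evenWinsBeyondArch_of_forall_le fun a ha ↦
    (weilEvenGroundEnergy_lt_weilOddGroundEnergy_of_noCrossing log_two_half_pos h₁
      weilEvenGroundEnergy_lt_weilOddGroundEnergy_log_two_half hne ha).le

/-- **Line `birth` with its RH-free stub discharged** (`Theorems.stub_sectorContinuity`): parity-free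
simplicity of the bottom for every `a > (log 2)/2` ALONE implies the crux. [folklore] -/
theorem evenWinsBeyondArch_of_bottomSimpleBeyondArch
    (h : ∀ a : ℝ, Real.log 2 / 2 < a → ∃ φ : ℝ → ℂ, ∃ δ : ℝ, 0 < δ ∧ ∀ g : ℝ → ℂ, IsWeilTest g →
      tsupport g ⊆ Set.Icc (-a) a → ∫ t, ‖g t‖ ^ 2 = (1 : ℝ) →
        ∫ t, starRingEnd ℂ (φ t) * g t = 0 → weilGroundEnergy a + δ ≤ (weilQuadratic g).re) :
    Summit.RiemannHypothesis.RiemannHypothesis.Theses.WeilParity.EvenWinsBeyondArch :=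
  evenWinsBeyondArch_of_sectorContinuity_of_bottomSimple stub_sectorContinuity h

/-! ## The sister crux implies this one -/

/-- **Kill criterion k4, kernel-checked**: route WeilGroundState's crux `GroundStateSimpleEven`
(stmt-RiemannHypothesis-1526; at `a > 0` it is `WeilWindowSimpleEven a` verbatim) implies the crux. [folklore] -/
theorem evenWinsBeyondArch_of_groundStateSimpleEven
    (h : Summit.RiemannHypothesis.RiemannHypothesis.Theses.WeilGroundState.GroundStateSimpleEven) :
    Summit.RiemannHypothesis.RiemannHypothesis.Theses.WeilParity.EvenWinsBeyondArch :=
  evenWinsBeyondArch_of_forall_le fun a ha ↦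
    (weilEvenGroundEnergy_lt_weilOddGroundEnergy_of_weilWindowSimpleEven (log_two_half_pos.trans ha)
      (h a (log_two_half_pos.trans ha))).le

end Summit.RiemannHypothesis.RiemannHypothesis.Theorems.EvenWinsBeyondArch
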